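import Literature.AlgebraicGeometry.AbelianSchemes.SerreTensorRecognitionOfPoints
import Literature.AlgebraicGeometry.AbelianSchemes.CoverSurjectiveOfSerrePresentation
import Literature.NumberTheory.NumberFields.SerreTensorPresentationOfIdeal
import Mathlib.RingTheory.FractionalIdeal.Operations
import HarnessLib

/-!
# Serre class invariance of the ideal quotient: `A ∕ A[𝔞₁] ≅ A ∕ A[𝔞₂]` for ideals in the same class
# ([MumfordAV1970] §7 Thm. 4; [Conrad2004GrossZagier] §7 Thm. 7.5; [MilneCM2006] §7)

Topic `Literature/AlgebraicGeometry/AbelianSchemes`, namespace `Literature.AlgebraicGeometry.AbelianSchemes.AbelianSchemeOver`.  THEOREMS ONLY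
(no definition, no named fact, no `instance`, no notation, no `sorry`).  Cell `hodgecm-mathlib` (D-0151), FLOOR 0, P6 «MOD programme» (crux
hLiu418 = stmt-HodgeConjecture-24832, `--supports`, count-neutral), line L3 (socket `stub_FROB` → `stub_ROOF0`), RULING «DUAL-B̄» #5 organ **(B)
«SERRE CLASS INVARIANCE» `E : Q ≅ B̄`** (LA3-plan (g0) 2026-09-02T04:40:37Z → A-p14 (g37)): the engine's quotient `Q = A ∕ A[𝔟]` and the reduction
`B̄ = A ∕ A[𝔭_w]` have kernel laws `A[𝔞₁]`, `A[𝔞₂]` with `𝔞₂ = x·𝔞₁` in the class group; ★ `DualPair.ofIso` then transports the dual pair along a BARE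
isomorphism of group schemes `Q₁ ≅ Q₂` — which this file supplies.  HC_CM is proved only modulo the printed citations (2 remaining named inputs
hLiu418 24832, h413 24833) until rung 0 closes; this file is generic and changes no count.

THE MATHEMATICS.  `Ω` algebraically closed (any characteristic), `A` an abelian scheme over `Spec Ω` with commutative group law and an action
`ι : 𝓞 F → End(A)` of the integers of a number field; `qᵢ : A → Qᵢ` (`i = 1, 2`) SURJECTIVE homomorphisms with KERNEL LAW `A[𝔞ᵢ]` as subgroup
functors («`t ≫ qᵢ = 1 ↔ ∀ c ∈ 𝔞ᵢ, t ≫ ι(c) = 1`» on all `T`-points — the shape of (S-c) ∕ `Roof₀` (r2₀) ∕ ★ KER-EQ), `𝔞ᵢ ≠ 0`, and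
`𝔞₂ = (x)·𝔞₁` for some `x ∈ F` (equivalently `(b)·𝔞₂ = (a)·𝔞₁` with `x = a∕b`, `a, b ∈ 𝓞 F ∖ 0`).  THEN `Q₁ ≅ Q₂` as group schemes.  PROOF: the
composites `φ₁ := ι(a) ≫ q₁`, `φ₂ := ι(b) ≫ q₂` are SURJECTIVE homomorphisms (`ι(a)` is surjective: `a·a′ = Nm(a) ∈ ℕ ∖ 0`, so `ι(a′) ≫ ι(a) = [Nm a]`,
★ `surjective_left_of_comp_eq_i_natCast`) with the SAME kernel law `A[𝔠]`, `𝔠 := (a)·𝔞₁ = (b)·𝔞₂` (`t ≫ ι(a) ≫ q₁ = 1 ↔ ∀ c ∈ 𝔞₁, t ≫ ι(ac) = 1`);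
choose ONE Serre presentation `(E, P, Q, N)` of `𝔠` (★ `exists_serrePresentation_of_ideal`, `𝔟 = E·𝒪ᵐ ≅ 𝔠⁻¹`); the rank-free recognition ★ KER-EQ
`exists_iso_serreTranslate_comp_eq_of_comp_eq_one_iff_forall_mem` ([MumfordAV1970] §7 Thm. 4: a surjective homomorphism is determined by its kernel)
gives homomorphic isomorphisms `e₁ : A ⊗_𝒪 𝔟 ≅ Q₁`, `e₂ : A ⊗_𝒪 𝔟 ≅ Q₂`, and `E := e₁⁻¹ ≫ e₂`.  (This is Serre's `A ⊗_𝒪 𝔞₁⁻¹ ≅ A ⊗_𝒪 𝔞₂⁻¹` for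
`𝔞₁⁻¹ ≅ 𝔞₂⁻¹`, [Conrad2004GrossZagier] §7, obtained without the module-map functoriality.)  No compatibility of `E` with `q₁, q₂` is asserted (there
is none unless `x` is a unit).

* §1 `comp_i_comp_eq_one_iff_forall_mem_span_singleton_mul` — kernel law of `ι(a) ≫ q` is `A[(a)·𝔞]` (any coefficient ring `𝒪`);
  `RingAction.surjective_i_left_of_mul_eq_natCast` (any `𝒪`: `a·a′ = N ≠ 0`), `RingAction.surjective_i_left_of_ne_zero` (`𝒪 = 𝓞 F`, `a ≠ 0`).
* §2 **`exists_iso_of_kernelLaw_idealTorsion_of_span_mul_eq`** — the integral form `(a)·𝔞₁ = (b)·𝔞₂ ⇒ ∃ E : Q₁.X ≅ Q₂.X, IsMonHom E.hom ∧ IsMonHom E.inv`.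
* §3 **`exists_iso_of_kernelLaw_idealTorsion_of_classEq`** — THE HEAD in the class-group currency `(𝔞₂ : FractionalIdeal (𝓞 F)⁰ F) = spanSingleton x * 𝔞₁`.
* §4 (ED. 2) **`exists_iso_sq_of_kernelLaw_idealTorsion_of_span_mul_eq`**, **`exists_iso_sq_of_kernelLaw_idealTorsion_of_classEq`** — the same isomorphism WITH
  THE SQUARE `ι(a) ≫ q₁ ≫ E.hom = ι(b) ≫ q₂` (the `hsq` binder of ★ `RoofMiddleTransportAlongIso`).

## References
* [MumfordAV1970] D. Mumford, *Abelian Varieties* (1970), §7 Thm. 4 (p. 72) (a separable∕fppf quotient is determined by its kernel), §6 Application 2 (p. 62).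
* [Conrad2004GrossZagier] B. Conrad, *Gross–Zagier revisited*, MSRI Publ. 49 (2004), §7 «The Serre tensor construction», Thm. 7.5.
* [MilneCM2006] J. S. Milne, *Complex Multiplication* (2006), §7 «𝔞-multiplications» (Def. 7.19, Prop. 7.22, Rem. 7.23, pp. 58–59).
* [Neukirch1999] J. Neukirch, *Algebraic Number Theory* (1999), Ch. I §3 (3.8)–(3.9) (invertibility of ideals of `𝓞 F`; the class group).
-/

set_option autoImplicit false

noncomputable section

universe u

open CategoryTheory CategoryTheory.Limits AlgebraicGeometry MonoidalCategory NumberField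
open scoped MonObj nonZeroDivisors

namespace Literature.AlgebraicGeometry.AbelianSchemes

namespace AbelianSchemeOver

open Literature.NumberTheory.NumberFields.SerrePresentation

/-! ## §1 The kernel law of `ι(a) ≫ q`; surjectivity of `ι(a)` -/

section AnyRing

variable {S : Scheme.{u}} {A B : AbelianSchemeOver S} {O : Type*} [CommRing O] (act : A.RingAction O)

/-- **The kernel law of `ι(a) ≫ q` is `A[(a)·𝔞]`**: if `q : A → B` kills exactly the `𝔞`-torsion on all `T`-points (`t ≫ q = 1 ↔ ∀ c ∈ 𝔞, t ≫ ι(c) = 1`),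
then `t ≫ ι(a) ≫ q = 1 ↔ ∀ d ∈ (a)·𝔞, t ≫ ι(d) = 1` (`ι(a) ≫ ι(c) = ι(ca)`, Mathlib `Ideal.mem_span_singleton_mul`).
[cite: MilneCM2006, §7 (Def. 7.19, Prop. 7.22, Rem. 7.23, pp. 58–59)] -/
theorem comp_i_comp_eq_one_iff_forall_mem_span_singleton_mul (q : A.X ⟶ B.X) {𝔞 : Ideal O}
    (hker : ∀ ⦃T : Over S⦄ (t : T ⟶ A.X), t ≫ q = 1 ↔ ∀ c ∈ 𝔞, t ≫ act.i c = 1) (a : O) ⦃T : Over S⦄ (t : T ⟶ A.X) :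
    t ≫ (act.i a ≫ q) = 1 ↔ ∀ d ∈ Ideal.span {a} * 𝔞, t ≫ act.i d = 1 := by
  rw [← Category.assoc, hker]
  constructor
  · intro h d hd
    obtain ⟨c, hc, rfl⟩ := Ideal.mem_span_singleton_mul.mp hd
    rw [mul_comm, act.i_mul, ← Category.assoc]
    exact h c hc
  · intro h c hc
    have h' := h (a * c) (Ideal.mem_span_singleton_mul.mpr ⟨c, hc, rfl⟩)
    rwa [mul_comm, act.i_mul, ← Category.assoc] at h'

/-- **`ι(a)` is surjective when `a·a′ = N ≠ 0` for some natural number `N`** (`ι(a′) ≫ ι(a) = ι(N) = [N]`, which is surjective on an abelian scheme for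
`N ≠ 0`, ★ `surjective_left_of_comp_eq_i_natCast`). [cite: MumfordAV1970, §6 Application 2 (p. 62)] -/
theorem RingAction.surjective_i_left_of_mul_eq_natCast {a a' : O} {N : ℕ} (hN : N ≠ 0) (h : a * a' = (N : O)) :
    Surjective (act.i a).left :=
  surjective_left_of_comp_eq_i_natCast act (act.i a) (act.i a') hN (by rw [← act.i_mul, h])

end AnyRing

section NumberField

variable {S : Scheme.{u}} {A : AbelianSchemeOver S} {F : Type*} [Field F] [NumberField F] (act : A.RingAction (𝓞 F))

/-- **`ι(a)` is surjective for every nonzero `a ∈ 𝓞 F`**: `a` divides its absolute norm `Nm(a) = #(𝓞 F ∕ (a)) ∈ ℕ ∖ 0` (Mathlib `Ideal.absNorm_mem`).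
[cite: MumfordAV1970, §6 Application 2 (p. 62)] [cite: Neukirch1999, Ch. I §3 (3.8)–(3.9)] -/
theorem RingAction.surjective_i_left_of_ne_zero (a : 𝓞 F) (ha : a ≠ 0) : Surjective (act.i a).left := by
  have hN : Ideal.absNorm (Ideal.span ({a} : Set (𝓞 F))) ≠ 0 := fun h =>
    ha (Ideal.span_singleton_eq_bot.mp (Ideal.absNorm_eq_zero_iff.mp h))
  obtain ⟨a', ha'⟩ := Ideal.mem_span_singleton'.mp (Ideal.absNorm_mem (Ideal.span ({a} : Set (𝓞 F))))
  exact act.surjective_i_left_of_mul_eq_natCast hN ((mul_comm a a').trans ha')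

end NumberField

/-! ## §2 The integral form: `(a)·𝔞₁ = (b)·𝔞₂ ⇒ A ∕ A[𝔞₁] ≅ A ∕ A[𝔞₂]` -/

section Quotients

variable {Ω : Type u} [Field Ω] [IsAlgClosed Ω] {A Q₁ Q₂ : AbelianSchemeOver (Spec (.of Ω))} [IsCommMonObj A.X]
  {F : Type*} [Field F] [NumberField F] (act : A.RingAction (𝓞 F))
  (q₁ : A.X ⟶ Q₁.X) (q₂ : A.X ⟶ Q₂.X) [IsMonHom q₁] [IsMonHom q₂] [Surjective q₁.left] [Surjective q₂.left]

/-- **SERRE CLASS INVARIANCE, INTEGRAL FORM.**  `Ω` algebraically closed, `A ∕ Spec Ω` with commutative group law and an `𝓞 F`-action; `q₁ : A → Q₁`,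
`q₂ : A → Q₂` surjective homomorphisms with kernel laws `A[𝔞₁]`, `A[𝔞₂]` as subgroup functors, `𝔞₁ ≠ 0`, and `(a)·𝔞₁ = (b)·𝔞₂` with `a, b ≠ 0`: then
`∃ E : Q₁.X ≅ Q₂.X` with `E.hom`, `E.inv` homomorphisms.  Proof: `ι(a) ≫ q₁` and `ι(b) ≫ q₂` are surjective homomorphisms with the same kernel law `A[𝔠]`,
`𝔠 = (a)·𝔞₁` (§1); one Serre presentation of `𝔠` (★ `exists_serrePresentation_of_ideal`) and ★ KER-EQ twice give `A ⊗_𝒪 𝔟 ≅ Q₁`, `A ⊗_𝒪 𝔟 ≅ Q₂`.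
[cite: MumfordAV1970, §7 Thm. 4 (p. 72)] [cite: Conrad2004GrossZagier, §7 (Thm. 7.5)] [cite: MilneCM2006, §7 (Def. 7.19, Prop. 7.22, Rem. 7.23, pp. 58–59)] -/
theorem exists_iso_of_kernelLaw_idealTorsion_of_span_mul_eq {𝔞₁ 𝔞₂ : Ideal (𝓞 F)} (h𝔞₁ : 𝔞₁ ≠ ⊥)
    (hker₁ : ∀ ⦃T : Over (Spec (.of Ω))⦄ (t : T ⟶ A.X), t ≫ q₁ = 1 ↔ ∀ c ∈ 𝔞₁, t ≫ act.i c = 1)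
    (hker₂ : ∀ ⦃T : Over (Spec (.of Ω))⦄ (t : T ⟶ A.X), t ≫ q₂ = 1 ↔ ∀ c ∈ 𝔞₂, t ≫ act.i c = 1)
    {a b : 𝓞 F} (ha : a ≠ 0) (hb : b ≠ 0) (hab : Ideal.span {a} * 𝔞₁ = Ideal.span {b} * 𝔞₂) :
    ∃ E : Q₁.X ≅ Q₂.X, IsMonHom E.hom ∧ IsMonHom E.inv := by
  -- the common ideal `𝔠 := (a)·𝔞₁ = (b)·𝔞₂` and ONE Serre presentation of it
  have h𝔠 : Ideal.span {a} * 𝔞₁ ≠ ⊥ := fun h =>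
    (Ideal.mul_eq_bot.mp h).elim (fun h1 => ha (Ideal.span_singleton_eq_bot.mp h1)) h𝔞₁
  obtain ⟨m, E, hE, P, Qr, N, hN, hEP, hQE, hQP, hPQ, hspan, -, -⟩ := exists_serrePresentation_of_ideal (Ideal.span {a} * 𝔞₁) h𝔠
  -- the two surjective homomorphisms `ι(a) ≫ q₁`, `ι(b) ≫ q₂` with kernel law `A[𝔠]`
  haveI := act.isMonHom a
  haveI := act.isMonHom b
  haveI : Surjective (act.i a).left := RingAction.surjective_i_left_of_ne_zero act a ha
  haveI : Surjective (act.i b).left := RingAction.surjective_i_left_of_ne_zero act b hb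
  haveI : Surjective (act.i a ≫ q₁).left := by rw [Over.comp_left]; infer_instance
  haveI : Surjective (act.i b ≫ q₂).left := by rw [Over.comp_left]; infer_instance
  have hk₁ : ∀ ⦃T : Over (Spec (.of Ω))⦄ (t : T ⟶ A.X), t ≫ (act.i a ≫ q₁) = 1 ↔ ∀ d ∈ Ideal.span {a} * 𝔞₁, t ≫ act.i d = 1 :=
    comp_i_comp_eq_one_iff_forall_mem_span_singleton_mul act q₁ hker₁ a
  have hk₂ : ∀ ⦃T : Over (Spec (.of Ω))⦄ (t : T ⟶ A.X), t ≫ (act.i b ≫ q₂) = 1 ↔ ∀ d ∈ Ideal.span {a} * 𝔞₁, t ≫ act.i d = 1 := by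
    rw [hab]
    exact comp_i_comp_eq_one_iff_forall_mem_span_singleton_mul act q₂ hker₂ b
  -- KER-EQ twice
  obtain ⟨e₁, -, he₁, -⟩ := exists_iso_serreTranslate_comp_eq_of_comp_eq_one_iff_forall_mem act E hE P Qr (act.i a ≫ q₁)
    hN hEP hQE hQP hPQ hspan hk₁
  obtain ⟨e₂, -, he₂, -⟩ := exists_iso_serreTranslate_comp_eq_of_comp_eq_one_iff_forall_mem act E hE P Qr (act.i b ≫ q₂)
    hN hEP hQE hQP hPQ hspan hk₂
  haveI := he₁
  haveI := he₂
  haveI : IsMonHom e₁.inv := inferInstance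
  haveI : IsMonHom e₂.inv := inferInstance
  refine ⟨e₁.symm ≪≫ e₂, ?_, ?_⟩
  · change IsMonHom (e₁.inv ≫ e₂.hom)
    infer_instance
  · change IsMonHom (e₂.inv ≫ e₁.hom)
    infer_instance

/-! ## §3 The head in the class-group currency -/

/-- **SERRE CLASS INVARIANCE OF THE IDEAL QUOTIENT** (organ (B) «`E : Q ≅ B̄`»): `Ω` algebraically closed of any characteristic, `A ∕ Spec Ω` with
commutative group law and an `𝓞 F`-action `ι`; `q₁ : A → Q₁`, `q₂ : A → Q₂` surjective homomorphisms with kernel laws `A[𝔞₁]`, `A[𝔞₂]` as subgroup functors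
(`t ≫ qᵢ = 1 ↔ ∀ c ∈ 𝔞ᵢ, t ≫ ι(c) = 1` on all `T`-points), `𝔞₁, 𝔞₂ ≠ 0` IN THE SAME IDEAL CLASS: `𝔞₂ = (x)·𝔞₁` as fractional ideals for some `x ∈ F`.
THEN `∃ E : Q₁.X ≅ Q₂.X` with `E.hom` and `E.inv` homomorphisms — `A ⊗_𝒪 𝔞₁⁻¹ ≅ A ⊗_𝒪 𝔞₂⁻¹` ([Conrad2004GrossZagier] §7; [MumfordAV1970] §7 Thm. 4).  Write
`x = a∕b` (`IsFractionRing.div_surjective`); then `(b)·𝔞₂ = (a)·𝔞₁` as ideals and §2 applies.  The isomorphism is NOT asserted compatible with `q₁, q₂`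
(★ `DualPair.ofIso` consumes a bare isomorphism). [cite: MumfordAV1970, §7 Thm. 4 (p. 72)] [cite: Conrad2004GrossZagier, §7 (Thm. 7.5)]
[cite: Neukirch1999, Ch. I §3 (3.8)–(3.9)] -/
theorem exists_iso_of_kernelLaw_idealTorsion_of_classEq {𝔞₁ 𝔞₂ : Ideal (𝓞 F)} (h𝔞₁ : 𝔞₁ ≠ ⊥) (h𝔞₂ : 𝔞₂ ≠ ⊥)
    (hker₁ : ∀ ⦃T : Over (Spec (.of Ω))⦄ (t : T ⟶ A.X), t ≫ q₁ = 1 ↔ ∀ c ∈ 𝔞₁, t ≫ act.i c = 1)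
    (hker₂ : ∀ ⦃T : Over (Spec (.of Ω))⦄ (t : T ⟶ A.X), t ≫ q₂ = 1 ↔ ∀ c ∈ 𝔞₂, t ≫ act.i c = 1)
    {x : F} (hx : (𝔞₂ : FractionalIdeal (𝓞 F)⁰ F) = FractionalIdeal.spanSingleton (𝓞 F)⁰ x * (𝔞₁ : FractionalIdeal (𝓞 F)⁰ F)) :
    ∃ E : Q₁.X ≅ Q₂.X, IsMonHom E.hom ∧ IsMonHom E.inv := by
  -- `x = a / b` with `a, b ∈ 𝓞 F`, `b ≠ 0`
  obtain ⟨a, b, hb0, hxab⟩ := IsFractionRing.div_surjective (A := 𝓞 F) x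
  have hb : b ≠ 0 := nonZeroDivisors.ne_zero hb0
  have hbF : (algebraMap (𝓞 F) F b) ≠ 0 := fun h => hb ((map_eq_zero_iff _ (FaithfulSMul.algebraMap_injective (𝓞 F) F)).mp h)
  -- `(b)·𝔞₂ = (a)·𝔞₁` as fractional ideals, hence as ideals
  have hfrac : ((Ideal.span {b} * 𝔞₂ : Ideal (𝓞 F)) : FractionalIdeal (𝓞 F)⁰ F) =
      ((Ideal.span {a} * 𝔞₁ : Ideal (𝓞 F)) : FractionalIdeal (𝓞 F)⁰ F) := by
    rw [FractionalIdeal.coeIdeal_mul, FractionalIdeal.coeIdeal_mul, FractionalIdeal.coeIdeal_span_singleton,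
      FractionalIdeal.coeIdeal_span_singleton, hx, ← mul_assoc, FractionalIdeal.spanSingleton_mul_spanSingleton, ← hxab,
      mul_div_cancel₀ _ hbF]
  have hab : Ideal.span {a} * 𝔞₁ = Ideal.span {b} * 𝔞₂ := (FractionalIdeal.coeIdeal_injective hfrac).symm
  -- `a ≠ 0` since `𝔞₂ ≠ 0`
  have ha : a ≠ 0 := by
    rintro rfl
    apply h𝔞₂
    have h0 : Ideal.span {b} * 𝔞₂ = ⊥ := by
      rw [← hab, Ideal.span_singleton_eq_bot.mpr rfl, Ideal.bot_mul]
    exact ((Ideal.mul_eq_bot.mp h0).resolve_left fun h1 => hb (Ideal.span_singleton_eq_bot.mp h1))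
  exact exists_iso_of_kernelLaw_idealTorsion_of_span_mul_eq act q₁ q₂ h𝔞₁ hker₁ hker₂ ha hb hab

end Quotients

/-! ## §4 (ED. 2) The same WITH THE SQUARE `ι(a) ≫ q₁ ≫ E = ι(b) ≫ q₂` — the `hsq` input of ★ `RoofMiddleTransportAlongIso` -/

section QuotientsSquare

variable {Ω : Type u} [Field Ω] [IsAlgClosed Ω] {A Q₁ Q₂ : AbelianSchemeOver (Spec (.of Ω))} [IsCommMonObj A.X]
  {F : Type*} [Field F] [NumberField F] (act : A.RingAction (𝓞 F))
  (q₁ : A.X ⟶ Q₁.X) (q₂ : A.X ⟶ Q₂.X) [IsMonHom q₁] [IsMonHom q₂] [Surjective q₁.left] [Surjective q₂.left]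

/-- **SERRE CLASS INVARIANCE WITH ITS SQUARE, INTEGRAL FORM.**  Under the hypotheses of `exists_iso_of_kernelLaw_idealTorsion_of_span_mul_eq`
(`(a)·𝔞₁ = (b)·𝔞₂`, `a, b ≠ 0`) the isomorphism `E : Q₁ ≅ Q₂` can be chosen with the COMMUTING SQUARE **`ι(a) ≫ q₁ ≫ E.hom = ι(b) ≫ q₂`** — both sides
are the Serre translation `ψ_P : A → A ⊗_𝒪 𝔟` of the common presentation read through the two recognitions (`ψ_P ≫ e₁ = ι(a) ≫ q₁`, `ψ_P ≫ e₂ = ι(b) ≫ q₂`,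
`E = e₁⁻¹ ≫ e₂`).  This is the binder `hsq : σ ≫ q ≫ E.hom = τ ≫ c` of ★ `RoofMiddleTransportAlongIso.conj_comp_inv_comp_lam_comp_dualIsogenyOver_ofIso`
with `σ := ι(a)`, `τ := ι(b)` (L3 ROOF legs, (r3₀) for `lamB := E.inv ≫ λ_Q`). [cite: MumfordAV1970, §7 Thm. 4 (p. 72)] [cite: Conrad2004GrossZagier, §7 (Thm. 7.5)]
[cite: MilneCM2006, §7 (Def. 7.19, Prop. 7.22, Rem. 7.23, pp. 58–59)] -/
theorem exists_iso_sq_of_kernelLaw_idealTorsion_of_span_mul_eq {𝔞₁ 𝔞₂ : Ideal (𝓞 F)} (h𝔞₁ : 𝔞₁ ≠ ⊥)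
    (hker₁ : ∀ ⦃T : Over (Spec (.of Ω))⦄ (t : T ⟶ A.X), t ≫ q₁ = 1 ↔ ∀ c ∈ 𝔞₁, t ≫ act.i c = 1)
    (hker₂ : ∀ ⦃T : Over (Spec (.of Ω))⦄ (t : T ⟶ A.X), t ≫ q₂ = 1 ↔ ∀ c ∈ 𝔞₂, t ≫ act.i c = 1)
    {a b : 𝓞 F} (ha : a ≠ 0) (hb : b ≠ 0) (hab : Ideal.span {a} * 𝔞₁ = Ideal.span {b} * 𝔞₂) :
    ∃ E : Q₁.X ≅ Q₂.X, IsMonHom E.hom ∧ IsMonHom E.inv ∧ act.i a ≫ q₁ ≫ E.hom = act.i b ≫ q₂ := by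
  -- the common ideal `𝔠 := (a)·𝔞₁ = (b)·𝔞₂` and ONE Serre presentation of it
  have h𝔠 : Ideal.span {a} * 𝔞₁ ≠ ⊥ := fun h =>
    (Ideal.mul_eq_bot.mp h).elim (fun h1 => ha (Ideal.span_singleton_eq_bot.mp h1)) h𝔞₁
  obtain ⟨m, E, hE, P, Qr, N, hN, hEP, hQE, hQP, hPQ, hspan, -, -⟩ := exists_serrePresentation_of_ideal (Ideal.span {a} * 𝔞₁) h𝔠
  haveI := act.isMonHom a
  haveI := act.isMonHom b
  haveI : Surjective (act.i a).left := RingAction.surjective_i_left_of_ne_zero act a ha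
  haveI : Surjective (act.i b).left := RingAction.surjective_i_left_of_ne_zero act b hb
  haveI : Surjective (act.i a ≫ q₁).left := by rw [Over.comp_left]; infer_instance
  haveI : Surjective (act.i b ≫ q₂).left := by rw [Over.comp_left]; infer_instance
  have hk₁ : ∀ ⦃T : Over (Spec (.of Ω))⦄ (t : T ⟶ A.X), t ≫ (act.i a ≫ q₁) = 1 ↔ ∀ d ∈ Ideal.span {a} * 𝔞₁, t ≫ act.i d = 1 :=
    comp_i_comp_eq_one_iff_forall_mem_span_singleton_mul act q₁ hker₁ a
  have hk₂ : ∀ ⦃T : Over (Spec (.of Ω))⦄ (t : T ⟶ A.X), t ≫ (act.i b ≫ q₂) = 1 ↔ ∀ d ∈ Ideal.span {a} * 𝔞₁, t ≫ act.i d = 1 := by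
    rw [hab]
    exact comp_i_comp_eq_one_iff_forall_mem_span_singleton_mul act q₂ hker₂ b
  -- KER-EQ twice, keeping the factorisations `ψ_P ≫ eᵢ = ι(·) ≫ qᵢ`
  obtain ⟨e₁, he₁, hm₁, -⟩ := exists_iso_serreTranslate_comp_eq_of_comp_eq_one_iff_forall_mem act E hE P Qr (act.i a ≫ q₁)
    hN hEP hQE hQP hPQ hspan hk₁
  obtain ⟨e₂, he₂, hm₂, -⟩ := exists_iso_serreTranslate_comp_eq_of_comp_eq_one_iff_forall_mem act E hE P Qr (act.i b ≫ q₂)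
    hN hEP hQE hQP hPQ hspan hk₂
  haveI := hm₁
  haveI := hm₂
  haveI : IsMonHom e₁.inv := inferInstance
  haveI : IsMonHom e₂.inv := inferInstance
  refine ⟨e₁.symm ≪≫ e₂, ?_, ?_, ?_⟩
  · change IsMonHom (e₁.inv ≫ e₂.hom)
    infer_instance
  · change IsMonHom (e₂.inv ≫ e₁.hom)
    infer_instance
  · -- `ι(a) ≫ q₁ ≫ e₁⁻¹ ≫ e₂ = ψ_P ≫ e₂ = ι(b) ≫ q₂`
    change act.i a ≫ q₁ ≫ (e₁.inv ≫ e₂.hom) = act.i b ≫ q₂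
    rw [← Category.assoc, ← he₁, Category.assoc, e₁.hom_inv_id_assoc, he₂]

/-- **SERRE CLASS INVARIANCE WITH ITS SQUARE, CLASS-GROUP FORM.**  For `𝔞₂ = (x)·𝔞₁` (`x ∈ F`) there are nonzero `a, b ∈ 𝓞 F` with `x = a∕b`,
`(a)·𝔞₁ = (b)·𝔞₂`, and an isomorphism of group schemes `E : Q₁ ≅ Q₂` with **`ι(a) ≫ q₁ ≫ E.hom = ι(b) ≫ q₂`** — the data `(σ, τ, E, hsq)` the L3 roof pen feeds to
★ `conj_comp_inv_comp_lam_comp_dualIsogenyOver_ofIso` (`σ := ι(a)`, `τ := ι(b)`). [cite: MumfordAV1970, §7 Thm. 4 (p. 72)] [cite: Conrad2004GrossZagier, §7 (Thm. 7.5)]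
[cite: Neukirch1999, Ch. I §3 (3.8)–(3.9)] -/
theorem exists_iso_sq_of_kernelLaw_idealTorsion_of_classEq {𝔞₁ 𝔞₂ : Ideal (𝓞 F)} (h𝔞₁ : 𝔞₁ ≠ ⊥) (h𝔞₂ : 𝔞₂ ≠ ⊥)
    (hker₁ : ∀ ⦃T : Over (Spec (.of Ω))⦄ (t : T ⟶ A.X), t ≫ q₁ = 1 ↔ ∀ c ∈ 𝔞₁, t ≫ act.i c = 1)
    (hker₂ : ∀ ⦃T : Over (Spec (.of Ω))⦄ (t : T ⟶ A.X), t ≫ q₂ = 1 ↔ ∀ c ∈ 𝔞₂, t ≫ act.i c = 1)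
    {x : F} (hx : (𝔞₂ : FractionalIdeal (𝓞 F)⁰ F) = FractionalIdeal.spanSingleton (𝓞 F)⁰ x * (𝔞₁ : FractionalIdeal (𝓞 F)⁰ F)) :
    ∃ (a b : 𝓞 F) (E : Q₁.X ≅ Q₂.X), a ≠ 0 ∧ b ≠ 0 ∧ algebraMap (𝓞 F) F a / algebraMap (𝓞 F) F b = x ∧
      Ideal.span {a} * 𝔞₁ = Ideal.span {b} * 𝔞₂ ∧ IsMonHom E.hom ∧ IsMonHom E.inv ∧ act.i a ≫ q₁ ≫ E.hom = act.i b ≫ q₂ := by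
  -- `x = a / b` with `a, b ∈ 𝓞 F`, `b ≠ 0`
  obtain ⟨a, b, hb0, hxab⟩ := IsFractionRing.div_surjective (A := 𝓞 F) x
  have hb : b ≠ 0 := nonZeroDivisors.ne_zero hb0
  have hbF : (algebraMap (𝓞 F) F b) ≠ 0 := fun h => hb ((map_eq_zero_iff _ (FaithfulSMul.algebraMap_injective (𝓞 F) F)).mp h)
  -- `(b)·𝔞₂ = (a)·𝔞₁` as fractional ideals, hence as ideals
  have hfrac : ((Ideal.span {b} * 𝔞₂ : Ideal (𝓞 F)) : FractionalIdeal (𝓞 F)⁰ F) =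
      ((Ideal.span {a} * 𝔞₁ : Ideal (𝓞 F)) : FractionalIdeal (𝓞 F)⁰ F) := by
    rw [FractionalIdeal.coeIdeal_mul, FractionalIdeal.coeIdeal_mul, FractionalIdeal.coeIdeal_span_singleton,
      FractionalIdeal.coeIdeal_span_singleton, hx, ← mul_assoc, FractionalIdeal.spanSingleton_mul_spanSingleton, ← hxab,
      mul_div_cancel₀ _ hbF]
  have hab : Ideal.span {a} * 𝔞₁ = Ideal.span {b} * 𝔞₂ := (FractionalIdeal.coeIdeal_injective hfrac).symm
  -- `a ≠ 0` since `𝔞₂ ≠ 0`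
  have ha : a ≠ 0 := by
    rintro rfl
    apply h𝔞₂
    have h0 : Ideal.span {b} * 𝔞₂ = ⊥ := by
      rw [← hab, Ideal.span_singleton_eq_bot.mpr rfl, Ideal.bot_mul]
    exact ((Ideal.mul_eq_bot.mp h0).resolve_left fun h1 => hb (Ideal.span_singleton_eq_bot.mp h1))
  obtain ⟨E, hE, hE', hsq⟩ := exists_iso_sq_of_kernelLaw_idealTorsion_of_span_mul_eq act q₁ q₂ h𝔞₁ hker₁ hker₂ ha hb hab
  exact ⟨a, b, E, ha, hb, hxab, hab, hE, hE', hsq⟩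

end QuotientsSquare

end AbelianSchemeOver

end Literature.AlgebraicGeometry.AbelianSchemes

end
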